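import Summits.BirchSwinnertonDyer.BirchSwinnertonDyer.Theorems.GoldfeldAllTwistsTwoConverseTwinBirchLocalFive
import Summits.BirchSwinnertonDyer.BirchSwinnertonDyer.Theorems.GoldfeldAllTwistsTwoConverseTwinGenusOddMultipleTrace
import Literature.NumberTheory.QuadraticForms.PadicSquares
import HarnessLib

set_option linter.dupNamespace false -- `…BirchSwinnertonDyer.BirchSwinnertonDyer…` is the cell's namespace (D-0017)
set_option autoImplicit false

/-!
# LINE B49 — THEOREM B, local input (B1b′): `c_q = 2` by the EXACT `I₀*` count, `c₂ = 4` on both `ℚ₂`-classes,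
# and the assembly **`Tam(W) = c₂·c₇·c_q = 16` for every model `W` of `49a1^{(−q)}`**, generic in the prime `q`

Cell `bsd-goldfeld`, seat `bsd-goldfeld-s1p-c301` (prover, gen 8); planner ruling g19 (liii), scope memo
`HOME/GENUS-THEOREM-B.md` factor F9 (`c_W = 16`). Support for item `stmt-BirchSwinnertonDyer-19140` (twin″);
Theses-free; theorems only. HONEST FRAMING: local arithmetic of an explicit family of Weierstrass models; nothing
about `L`-values or BSD.

Setting: `q` prime, `q ≡ 1 (mod 4)`, `(q/7) = −1`; `V_q = X₀(49)^{(−4q)} = [0, 3q, 0, −32q², 64q³]` (file B1a: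
`twistModel_baseChange`, global minimality `isGloballyMinimal_twistModel`). WHAT IS PROVED:
* §1 **`c_q(V_q) = 2`**: over `ℤ_q` the model is Tate's Step-6 normal form (`a₂ = q·3`, `a₄ = q²·(−32)`,
  `a₆ = q³·64`, `a₁ = a₃ = 0`) with SEPARABLE residue cubic `T³ + 3T² − 32T + 64 = (T + 8)(T² − 5T + 8)`
  (discriminant `−2⁸·7³ ≢ 0 (mod q)`), whose only root in `𝔽_q` is `−8` since `(2T − 5)² = −7` has no solution
  (`(−7/q) = −1`, Mathlib `legendreSym.eq_neg_one_iff`, `PadicInt.residueField : 𝔽_q ≃ ZMod q`); the exact count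
  `[E(ℚ_q) : E₀(ℚ_q)] = 1 + #roots` (`Rank2Observatory.Tam.index_Istar_zero_eq_card_add_one`, Tate 1975 §7 case 6)
  gives `2`, read as `c_q` on the minimal model (`LocalIndex.localTamagawaNumber_eq_index_of_smul_eq_baseChange`).
* §2 **`c₂(V_q) = 4`**: `q ≡ 1 (mod 8)` ⇒ `q ∈ ℤ₂ˣ²` ⇒ `V_q ≅ X₀(49)^{(−4)}` over `ℚ₂`; `q ≡ 5 (mod 8)` ⇒ `5q ∈ ℤ₂ˣ²` ⇒
  `V_q ≅ X₀(49)^{(−20)}` over `ℚ₂` (Serre II.3.3 Thm 4 = tree `padicInt_isSquare_of_toZModPow_three_eq_one`; file B1a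
  `localTamagawaNumber_padic_quadraticTwist_eq_of_sq`; file B1b `…_neg_four` / `…_neg_twenty`).
* §3 **`Tam(V_q) = 16`** (`tamagawaProduct_eq_prod` over the places `2, 7, q` of `ℤ`, `Δ = −2¹²7³q⁶`) and
  **`tamagawaProduct_eq_sixteen_of_smul_eq`**: `Tam(W) = 16` for EVERY model `W = Cd • X₀(49)^{(d_K)}`, `K`
  imaginary quadratic with `d_K = −4q` (`tamagawaProduct_variableChange_eq`) — the constant `c_W` of `𝔮₄₉`.
Census: `∏ c_ℓ = 16` on all 1011 prime rows (TWIN-CENSUS-G3 §3). References: [Tate1975] §7; [Silverman1994] IV.9.4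
Steps 6–7, Table 4.1; [SilvermanAEC2009] VII.6, X.5 Cor. 5.4; [Serre1973] II.3.3 Thms 3–4.
-/

noncomputable section

open scoped Classical NumberField

open WeierstrassCurve IsDedekindDomain IsLocalRing Rat.HeightOneSpectrum
  Literature.NumberTheory.EllipticCurves Literature.NumberTheory.EllipticCurves.ModularForms
  Literature.NumberTheory.QuadraticForms
  Summit.BirchSwinnertonDyer.BirchSwinnertonDyer.Rank2Observatory.Tate
  Summit.BirchSwinnertonDyer.BirchSwinnertonDyer.Rank2Observatory.RootNumber
  Summit.BirchSwinnertonDyer.BirchSwinnertonDyer.Rank2Observatory.Tam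

namespace Summit.BirchSwinnertonDyer.BirchSwinnertonDyer.Theorems.GoldfeldGoodTwists

/-! ## §1 The place `q`: type `I₀*` with one rational residue root, `c_q = 2` -/

section PlaceQ

variable {q : ℕ}

/-- `q ≠ 2, 7` ⇒ `q ∤ 87808 = 2⁸·7³` ⇒ `87808 ≠ 0` in the residue field `𝔽_q` of `ℤ_q`. [folklore] -/
theorem residue_disc_ne_zero [Fact q.Prime] (hq2 : q ≠ 2) (hq7 : q ≠ 7) :
    (87808 : ResidueField ℤ_[q]) ≠ 0 := by
  have hq : q.Prime := Fact.out
  intro h0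
  have h1 := congrArg (PadicInt.residueField (p := q)) h0
  rw [map_ofNat, map_zero] at h1
  have h2 : q ∣ 87808 := (ZMod.natCast_eq_zero_iff 87808 q).mp (by exact_mod_cast h1)
  have h3 : q ∣ 2 ^ 8 * 7 ^ 3 := by norm_num; exact h2
  rcases (Nat.Prime.dvd_mul hq).mp h3 with h | h
  · exact hq2 ((Nat.prime_dvd_prime_iff_eq hq Nat.prime_two).mp (hq.dvd_of_dvd_pow h))
  · exact hq7 ((Nat.prime_dvd_prime_iff_eq hq (by norm_num)).mp (hq.dvd_of_dvd_pow h))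

/-- **The residue cubic `T³ + 3T² − 32T + 64 = (T + 8)(T² − 5T + 8)` has `−8` as its ONLY root in `𝔽_q`** when
`(−7/q) = −1`: a root of `T² − 5T + 8` would give `(2T − 5)² = −7`. [cite: Tate1975, §7 (case 6)] -/
theorem residue_cubic_root_iff [Fact q.Prime] (hl7 : legendreSym q (-7) = -1) (r : ResidueField ℤ_[q]) :
    r ^ 3 + 3 * r ^ 2 + (-32) * r + 64 = 0 ↔ r = -8 := by
  constructor
  · intro h
    have hfac : (r + 8) * (r ^ 2 - 5 * r + 8) = 0 := by linear_combination h
    rcases mul_eq_zero.mp hfac with h1 | h2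
    · linear_combination h1
    · exfalso
      have hsq : (2 * r - 5) ^ 2 = -7 := by linear_combination 4 * h2
      have h7 : IsSquare ((-7 : ℤ) : ZMod q) := by
        refine ⟨PadicInt.residueField (p := q) (2 * r - 5), ?_⟩
        rw [← sq, ← map_pow, hsq]
        push_cast
        rw [map_neg, map_ofNat]
      exact (legendreSym.eq_neg_one_iff (p := q)).mp hl7 h7
  · rintro rfl
    norm_num

/-- **`[E(ℚ_q) : E₀(ℚ_q)] = 2` for `V_q = [0, 3q, 0, −32q², 64q³]` over `ℤ_q`** (Step-6 normal form, exact
`I₀*` count with root set `{−8}`). [cite: Tate1975, §7 (case 6)] [cite: Silverman1994, IV.9.4 Step 6] -/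
theorem index_nonsingularReductionSubgroup_twist_q [Fact q.Prime] (hq7 : jacobiSym q 7 = -1) (hq4 : q % 4 = 1) :
    ((⟨0, 3 * q, 0, -32 * q ^ 2, 64 * q ^ 3⟩ : WeierstrassCurve ℤ_[q]).nonsingularReductionSubgroup
      (integers_valuationRing_valuation ℤ_[q] ℚ_[q])).index = 2 := by
  have hq : q.Prime := Fact.out
  obtain ⟨hq2, hq7'⟩ := ne_two_and_ne_seven_of_jacobiSym hq7
  have hl7 : legendreSym q (-7) = -1 := by
    rw [jacobiSym.legendreSym.to_jacobiSym, jacobiSym_neg_seven_eq hq hq4]; exact hq7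
  haveI : HenselianLocalRing ℤ_[q] :=
    { is_henselian := fun f hf a₀ h₁ h₂ =>
        HenselianRing.is_henselian (I := IsLocalRing.maximalIdeal ℤ_[q]) f hf a₀ h₁ (h₂.map _) }
  have hJ : (⟨0, 3 * q, 0, -32 * q ^ 2, 64 * q ^ 3⟩ : WeierstrassCurve ℤ_[q]) =
      (⟨0, 3 * q, 0, -32 * q ^ 2, 64 * q ^ 3⟩ : WeierstrassCurve ℤ).map (Int.castRingHom ℤ_[q]) := by
    ext <;> simp [WeierstrassCurve.map]
  have hΔ : (⟨0, 3 * q, 0, -32 * q ^ 2, 64 * q ^ 3⟩ : WeierstrassCurve ℤ_[q]).Δ ≠ 0 := by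
    rw [hJ, map_Δ, twistModel_Δ]
    simp only [eq_intCast, ne_eq, Int.cast_eq_zero, neg_eq_zero]
    have := hq.pos
    positivity
  have hdisc : residue ℤ_[q] (3 : ℤ_[q]) ^ 2 * residue ℤ_[q] (-32 : ℤ_[q]) ^ 2 -
      4 * residue ℤ_[q] (-32 : ℤ_[q]) ^ 3 - 4 * residue ℤ_[q] (3 : ℤ_[q]) ^ 3 * residue ℤ_[q] (64 : ℤ_[q]) -
      27 * residue ℤ_[q] (64 : ℤ_[q]) ^ 2 +
      18 * residue ℤ_[q] (3 : ℤ_[q]) * residue ℤ_[q] (-32 : ℤ_[q]) * residue ℤ_[q] (64 : ℤ_[q]) ≠ 0 := by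
    simp only [map_ofNat, map_neg]
    norm_num
    exact residue_disc_ne_zero hq2 hq7'
  have h := index_Istar_zero_eq_card_add_one (K := ℚ_[q])
    (⟨0, 3 * q, 0, -32 * q ^ 2, 64 * q ^ 3⟩ : WeierstrassCurve ℤ_[q]) PadicInt.irreducible_p
    (α := 0) (β := 3) (γ := 0) (δ := -32) (ε := 64) (by simp) (by simp only; ring) (by simp)
    (by simp only; ring) (by simp only; ring) hΔ hdisc {-8} (fun r => by
      rw [Finset.mem_singleton, ← residue_cubic_root_iff hl7 r]
      simp only [map_ofNat, map_neg])
  rw [h, Finset.card_singleton]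

/-- `V_q ⊗ ℚ ⊗ ℚ_q` is the base change of the `ℤ_q`-model. [folklore] -/
theorem twistModel_baseChange_padic (q p : ℕ) [Fact p.Prime] :
    ((⟨0, 3 * q, 0, -32 * q ^ 2, 64 * q ^ 3⟩ : WeierstrassCurve ℤ).baseChange ℚ).baseChange ℚ_[p] =
      (⟨0, 3 * q, 0, -32 * q ^ 2, 64 * q ^ 3⟩ : WeierstrassCurve ℤ_[p]).baseChange ℚ_[p] := by
  ext <;> simp only [baseChange, map_a₁, map_a₂, map_a₃, map_a₄, map_a₆, map_neg, map_mul, map_pow, map_ofNat,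
    map_natCast, map_zero, algebraMap_int_eq]

/-- **`c_q(V_q) = 2`** (Mathlib's `q`-adics): the index of §1 is the local Tamagawa number of the MINIMAL model
`V_q ⊗ ℚ_q` (global minimality, file B1a). [cite: Silverman1994, IV.9.4 Step 6 and Table 4.1] -/
theorem localTamagawaNumber_padic_twist_q [Fact q.Prime] (hq7 : jacobiSym q 7 = -1) (hq4 : q % 4 = 1) :
    (haveI := cm7.isElliptic_quadraticTwist (show (((-(4 * q) : ℤ)) : ℚ) ≠ 0 by
       have := (Fact.out : q.Prime).pos; exact_mod_cast (show (-(4 * (q : ℤ))) ≠ 0 by omega))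
     ((cm7.quadraticTwist (((-(4 * q) : ℤ)) : ℚ)).baseChange ℚ_[q]).localTamagawaNumber ℤ_[q]) = 2 := by
  have hq : q.Prime := Fact.out
  obtain ⟨hq2, hq7'⟩ := ne_two_and_ne_seven_of_jacobiSym hq7
  have hd : (((-(4 * q) : ℤ)) : ℚ) ≠ 0 := by
    have := hq.pos; exact_mod_cast (show (-(4 * (q : ℤ))) ≠ 0 by omega)
  haveI := cm7.isElliptic_quadraticTwist hd
  -- minimality at `q`
  set w : HeightOneSpectrum (𝓞 ℚ) := (primesEquiv (R := 𝓞 ℚ)).symm ⟨q, hq⟩ with hw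
  have hwq : ((primesEquiv w : Nat.Primes) : ℕ) = q := by rw [hw, Equiv.apply_symm_apply]
  haveI : ((⟨0, 3 * q, 0, -32 * q ^ 2, 64 * q ^ 3⟩ : WeierstrassCurve ℤ_[q]).baseChange ℚ_[q]).IsMinimal ℤ_[q] := by
    have hmin := (isGloballyMinimal_twistModel hq hq4 hq7').isMinimal w
    have h2 := (isMinimalAt_iff_isMinimal_padic w q hwq _).mp hmin
    rwa [twistModel_baseChange_padic] at h2
  have hJ : (1 : VariableChange ℚ_[q]) • (cm7.quadraticTwist (((-(4 * q) : ℤ)) : ℚ)).baseChange ℚ_[q] =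
      (⟨0, 3 * q, 0, -32 * q ^ 2, 64 * q ^ 3⟩ : WeierstrassCurve ℤ_[q]).baseChange ℚ_[q] := by
    rw [one_smul, ← twistModel_baseChange, twistModel_baseChange_padic]
  rw [LocalIndex.localTamagawaNumber_eq_index_of_smul_eq_baseChange _ _ _ hJ]
  exact index_nonsingularReductionSubgroup_twist_q hq7 hq4

end PlaceQ

/-! ## §2 The place `2`: `c₂(V_q) = 4` on both `ℚ₂`-classes -/

section PlaceTwo

variable {q : ℕ}

/-- A natural number `≡ 1 (mod 8)` is a square in `ℤ₂`. [cite: Serre1973, Ch. II §3.3 Thm 4] -/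
theorem isSquare_padicInt_two_of_mod_eight {n : ℕ} (hn : n % 8 = 1) : IsSquare ((n : ℤ_[2])) := by
  refine padicInt_isSquare_of_toZModPow_three_eq_one (p := 2) ?_
  rw [map_natCast]
  have h : (n : ZMod (2 ^ 3)) = ((n % 2 ^ 3 : ℕ) : ZMod (2 ^ 3)) := (ZMod.natCast_mod n (2 ^ 3)).symm
  rw [h, show n % 2 ^ 3 = 1 by norm_num; omega, Nat.cast_one]

/-- **`c₂(V_q) = 4`** for every prime `q ≡ 1 (mod 4)`: `q ≡ 1 (mod 8)` ⇒ `−4q = (−4)·θ²` in `ℚ₂`,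
`c₂(V_q) = c₂(X₀(49)^{(−4)}) = 4`; `q ≡ 5 (mod 8)` ⇒ `5q = s²`, `−4q = (−20)·(s/5)²`, `c₂(V_q) = c₂(X₀(49)^{(−20)}) = 4`.
[cite: Serre1973, Ch. II §3.3 Thm 4] [cite: Silverman1994, IV.9.4 Step 7 and Table 4.1] -/
theorem localTamagawaNumber_padic_twist_two (hq : q.Prime) (hq4 : q % 4 = 1) :
    (haveI := cm7.isElliptic_quadraticTwist (show (((-(4 * q) : ℤ)) : ℚ) ≠ 0 by
       have := hq.pos; exact_mod_cast (show (-(4 * (q : ℤ))) ≠ 0 by omega))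
     ((cm7.quadraticTwist (((-(4 * q) : ℤ)) : ℚ)).baseChange ℚ_[2]).localTamagawaNumber ℤ_[2]) = 4 := by
  have hd : (((-(4 * q) : ℤ)) : ℚ) ≠ 0 := by
    have := hq.pos; exact_mod_cast (show (-(4 * (q : ℤ))) ≠ 0 by omega)
  have hq0 : (q : ℚ_[2]) ≠ 0 := by exact_mod_cast hq.ne_zero
  have hcast : ((((-(4 * q) : ℤ)) : ℚ) : ℚ_[2]) = -4 * (q : ℚ_[2]) := by push_cast; ring
  rcases (show q % 8 = 1 ∨ q % 8 = 5 by omega) with h8 | h8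
  · obtain ⟨s, hs⟩ := isSquare_padicInt_two_of_mod_eight h8
    have hθ : ((s : ℤ_[2]) : ℚ_[2]) ≠ 0 := by
      intro h0
      rw [PadicInt.coe_eq_zero] at h0
      rw [h0, mul_zero] at hs
      exact hq.ne_zero (by exact_mod_cast hs)
    have h : ((((-(4 * q) : ℤ)) : ℚ) : ℚ_[2]) = ((-4 : ℚ) : ℚ_[2]) * ((s : ℤ_[2]) : ℚ_[2]) ^ 2 := by
      rw [hcast, sq, ← PadicInt.coe_mul, ← hs, PadicInt.coe_natCast]
      push_cast; ring
    rw [localTamagawaNumber_padic_quadraticTwist_eq_of_sq cm7 (by norm_num) hd hθ h]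
    exact localTamagawaNumber_padic_cm7_quadraticTwist_neg_four
  · obtain ⟨s, hs⟩ := isSquare_padicInt_two_of_mod_eight (n := 5 * q) (by omega)
    have hθ : ((s : ℤ_[2]) : ℚ_[2]) / 5 ≠ 0 := by
      refine div_ne_zero (fun h0 => ?_) (by norm_num)
      rw [PadicInt.coe_eq_zero] at h0
      rw [h0, mul_zero] at hs
      have : (5 * q : ℕ) = 0 := by exact_mod_cast hs
      omega
    have h : ((((-(4 * q) : ℤ)) : ℚ) : ℚ_[2]) = ((-20 : ℚ) : ℚ_[2]) * (((s : ℤ_[2]) : ℚ_[2]) / 5) ^ 2 := by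
      have hs' : ((5 * q : ℕ) : ℚ_[2]) = ((s : ℤ_[2]) : ℚ_[2]) * ((s : ℤ_[2]) : ℚ_[2]) := by
        rw [← PadicInt.coe_mul, ← hs, PadicInt.coe_natCast]
      rw [hcast, div_pow, sq, ← hs']
      push_cast; ring
    rw [localTamagawaNumber_padic_quadraticTwist_eq_of_sq cm7 (by norm_num) hd hθ h]
    exact localTamagawaNumber_padic_cm7_quadraticTwist_neg_twenty

end PlaceTwo

/-! ## §3 `Tam(V_q) = 16` and `Tam(W) = 16` for every model `W` of `49a1^{(−q)}` -/

section Assembly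

variable {q : ℕ}

/-- **`Tam(V_q) = c₂ · c₇ · c_q = 4 · 2 · 2 = 16`** (bad places `⊆ {2, 7, q}` since `Δ = −2¹²7³q⁶`; product formula
`tamagawaProduct_eq_prod`). [cite: Silverman1994, IV.9.4 and Table 4.1] [cite: SilvermanAEC2009, VII.6] -/
theorem tamagawaProduct_twist (hq : q.Prime) (hq4 : q % 4 = 1) (hq7 : jacobiSym q 7 = -1) :
    (haveI := cm7.isElliptic_quadraticTwist (show (((-(4 * q) : ℤ)) : ℚ) ≠ 0 by
       have := hq.pos; exact_mod_cast (show (-(4 * (q : ℤ))) ≠ 0 by omega))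
     (cm7.quadraticTwist (((-(4 * q) : ℤ)) : ℚ)).tamagawaProduct) = 16 := by
  obtain ⟨hq2, hq7'⟩ := ne_two_and_ne_seven_of_jacobiSym hq7
  have hd : (((-(4 * q) : ℤ)) : ℚ) ≠ 0 := by
    have := hq.pos; exact_mod_cast (show (-(4 * (q : ℤ))) ≠ 0 by omega)
  haveI := cm7.isElliptic_quadraticTwist hd
  haveI : Fact (Nat.Prime 2) := ⟨Nat.prime_two⟩
  haveI : Fact (Nat.Prime 7) := ⟨by norm_num⟩
  haveI : Fact q.Prime := ⟨hq⟩
  set v₂ : HeightOneSpectrum ℤ := (primesEquiv (R := ℤ)).symm ⟨2, Nat.prime_two⟩ with hv₂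
  set v₇ : HeightOneSpectrum ℤ := (primesEquiv (R := ℤ)).symm ⟨7, by norm_num⟩ with hv₇
  set vq : HeightOneSpectrum ℤ := (primesEquiv (R := ℤ)).symm ⟨q, hq⟩ with hvq
  have h2 : (primesEquiv v₂ : ℕ) = 2 := by rw [hv₂, Equiv.apply_symm_apply]
  have h7 : (primesEquiv v₇ : ℕ) = 7 := by rw [hv₇, Equiv.apply_symm_apply]
  have hqq : (primesEquiv vq : ℕ) = q := by rw [hvq, Equiv.apply_symm_apply]
  have hne27 : v₂ ≠ v₇ := by
    intro h; have := congrArg (fun v => (primesEquiv v : ℕ)) h; simp only [h2, h7] at this; omega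
  have hne2q : v₂ ≠ vq := by
    intro h; have := congrArg (fun v => (primesEquiv v : ℕ)) h; simp only [h2, hqq] at this; omega
  have hne7q : v₇ ≠ vq := by
    intro h; have := congrArg (fun v => (primesEquiv v : ℕ)) h; simp only [h7, hqq] at this; omega
  have hprod := tamagawaProduct_eq_prod (cm7.quadraticTwist (((-(4 * q) : ℤ)) : ℚ)) {v₂, v₇, vq} (by
    intro v hv
    by_contra hmem
    apply hv
    rw [← twistModel_baseChange]
    refine hasGoodReductionAt_of_not_dvd fun hdvd => hmem ?_
    rcases eq_of_prime_dvd_twistModel_Δ hq (prime_natGenerator v) hdvd with h | h | h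
    · have : v = v₂ := by
        apply (primesEquiv (R := ℤ)).injective
        exact Subtype.ext (by rw [h2]; exact h)
      simp [this]
    · have : v = v₇ := by
        apply (primesEquiv (R := ℤ)).injective
        exact Subtype.ext (by rw [h7]; exact h)
      simp [this]
    · have : v = vq := by
        apply (primesEquiv (R := ℤ)).injective
        exact Subtype.ext (by rw [hqq]; exact h)
      simp [this])
  rw [Finset.prod_insert (by simp [hne27, hne2q]), Finset.prod_pair hne7q] at hprod
  have c2 := localTamagawaNumber_padic_eq_of_forall_place (cm7.quadraticTwist (((-(4 * q) : ℤ)) : ℚ)) v₂ 2 h2 4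
    (fun w hw => by
      rw [← localTamagawaNumber_padic_eq_holds _ w 2 hw]
      exact localTamagawaNumber_padic_twist_two hq hq4)
  have c7 := localTamagawaNumber_padic_eq_of_forall_place (cm7.quadraticTwist (((-(4 * q) : ℤ)) : ℚ)) v₇ 7 h7 2
    (fun w hw => by
      rw [← localTamagawaNumber_padic_eq_holds _ w 7 hw]
      exact localTamagawaNumber_padic_twist_seven hq hq7)
  have cq := localTamagawaNumber_padic_eq_of_forall_place (cm7.quadraticTwist (((-(4 * q) : ℤ)) : ℚ)) vq q hqq 2
    (fun w hw => by
      rw [← localTamagawaNumber_padic_eq_holds _ w q hw]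
      exact localTamagawaNumber_padic_twist_q hq7 hq4)
  rw [hprod, c2, c7, cq]
  norm_num

variable {K : Type} [Field K] [NumberField K]

/-- **`∏ c_ℓ(W) = 16` FOR EVERY MODEL `W` OF `49a1^{(−q)}`** in the coordinates of `X049BirchLemmaEvenDiscr`
(`W = Cd • X₀(49)^{(d_K)}`, `K` imaginary quadratic with `d_K = −4q`, `q` prime, `(q/7) = −1`): the factor `c_W` of
`𝔮₄₉` is the constant `16 = 2⁴` (`Tam` is a `ℚ`-isomorphism invariant, `tamagawaProduct_variableChange_eq`).
[cite: Silverman1994, IV.9.4 and Table 4.1] [cite: SilvermanAEC2009, VII.6] -/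
theorem tamagawaProduct_eq_sixteen_of_smul_eq (hK : IsImaginaryQuadratic K) (hq : q.Prime)
    (hq7 : jacobiSym q 7 = -1) (hdK : NumberField.discr K = -(4 * (q : ℤ)))
    (W : WeierstrassCurve ℚ) [W.IsElliptic] (Cd : VariableChange ℚ)
    (hW : Cd • cm7.quadraticTwist (NumberField.discr K : ℚ) = W) : W.tamagawaProduct = 16 := by
  have hq4 : q % 4 = 1 := emod_four_of_discr_eq hK hq hq7 hdK
  have hd : (((-(4 * q) : ℤ)) : ℚ) ≠ 0 := by
    have := hq.pos; exact_mod_cast (show (-(4 * (q : ℤ))) ≠ 0 by omega)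
  haveI := cm7.isElliptic_quadraticTwist hd
  have hW' : W = Cd • cm7.quadraticTwist (((-(4 * q) : ℤ)) : ℚ) := by
    rw [← hW, hdK]
  have h := tamagawaProduct_variableChange_eq (cm7.quadraticTwist (((-(4 * q) : ℤ)) : ℚ)) Cd
  rw [← hW'] at h
  rw [h]
  exact tamagawaProduct_twist hq hq4 hq7

end Assembly

end Summit.BirchSwinnertonDyer.BirchSwinnertonDyer.Theorems.GoldfeldGoodTwists

end
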